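import Summits.QuantumAdvantage.QuantumAdvantage.Theorems.FactoringAssumption
import Summits.QuantumAdvantage.QuantumAdvantage.Theorems.WhiteBoxWalkWbwThesisCanon
import Summits.QuantumAdvantage.QuantumAdvantage.Theorems.WhiteBoxWalkWbwThesisFPQPolyTime
import Summits.QuantumAdvantage.QuantumAdvantage.Theorems.WhiteBoxWalkWbwThesisBridge
import Summits.QuantumAdvantage.QuantumAdvantage.Theorems.WhiteBoxWalkWbwThesisExtract
import Literature.Computability.Complexity.FPStringBricks

/-!
# Route `WhiteBoxWalk`, crux `WbwThesis` (stmt-QuantumAdvantage-2238), line `Sketch`: the factoring adversary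

Part (B) of stub `stub_weakOW` (weak one-wayness of the prime-pair product `fPQ` from the factoring
assumption): the REDUCTION.  Fix a PPT inverter `B` of `fPQ` and a parity bit `b`.  The adversary
`A_b` against the factoring assumption, on input `z' = ⟨1ᵐ, N⟩` (`N` the numeral of `P · Q`) with coins
`c`, forms the `fPQ`-image `1 · encW n N` of EVERY hard-branch block of length `n = 2m + b` with
halves `{P, Q}`, runs `x' = B(⟨1ⁿ, 1 · encW n N⟩; c)` with its own coins, and outputs the numeral of
the smaller half of `x'`, `encodeNat (min (pOf x') (qOf x'))`; its coin budget on inputs of length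
`ℓ` is `B`'s budget on length `3(2⌊(ℓ-1)/4⌋ + b) + 3` (`= |⟨1ⁿ, fPQ x⟩|` when `ℓ = |⟨1ᵐ, N⟩|`,
because `|encodeNat (P Q)| ∈ {2m-1, 2m}`).

* `A_b` is PPT (`WeakOW.exists_program`): its run map on `⟨z', c⟩` is ONE composite of the tree's
  polynomial-time bricks — projections `fstF`/`sndF`, the unary length `1ᵐ ++ 1ᵐ (++ [1])`, the
  fixed-width numeral `fstF ∘ padTakeFn` (`FPQ.fstF_padTakeFn_encodeNat`), the call
  `uncurry B.run ∘ boolUnpair ∈ FP`, the halves by `halfFn`/`takeFn`/`dropFn`, and the minimum by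
  `ltFn`/`iteFn`/`norm` — transported to the pair presentation by `PolyTimeComputable.of_encode_eq`;
  the coin budget is bounded by `p_B ∘ (3X + 6)` (`TM2Iter.eval_mono`).
* EVENT INCLUSION (`WeakOW.min_eq_of_fPQ_eq`): if `fPQ z = 1 · encW n (P Q)` for primes `P, Q` with
  `P Q < 2ⁿ`, then `z` is a hard-branch block of length `n` with `pOf z · qOf z = P Q` (the numerals
  are exact below `2ⁿ`, `Canon.bitsToNat_encW`), so `{pOf z, qOf z} = {P, Q}` by unique factorisation
  and `A_b` outputs exactly `encodeNat (min P Q)`.  Counting coin strings (same number of coins on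
  both sides, `RandAlg.pr_eq_uniformProb`), `B`'s inversion probability on the block
  `encW m P ++ encW m Q ++ 0ᵇ` is at most `A_b`'s factoring success on `⟨1ᵐ, P Q⟩`
  (`stub_weakOW_adversary`).

No new definitions: the adversary is an anonymous `RandAlg`; helper lemmas in sub-namespace `WeakOW`.

References: O. Goldreich, *Foundations of Cryptography I* (2001), §2.2.4.1 (`f_mult` is weakly
one-way under the factoring assumption); S. Arora, B. Barak, *Computational Complexity* (2009), §1.3.
-/

noncomputable section

set_option linter.dupNamespace false -- D-0017: single-problem summit ⇒ `QuantumAdvantage.QuantumAdvantage` by design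

namespace Summit.QuantumAdvantage.QuantumAdvantage.Theorems.WhiteBoxWalk

open Summit.QuantumAdvantage.QuantumAdvantage.Theorems (mbitPrimes mem_mbitPrimes)
open Literature.Computability.Cryptography Literature.Computability.Complexity
open Literature.Computability.Complexity.Brick (halfFn halfFn_mem_FP length_halfFn fstF sndF fstF_boolPair
  sndF_boolPair fstF_mem_FP sndF_mem_FP norm_mem_FP ltFn ltFn_boolPair ltFn_mem_FP padTakeFn
  padTakeFn_boolPair padTakeFn_mem_FP)
open Literature.Computability.Complexity.Plumb (takeFn takeFn_boolPair takeFn_mem_FP dropFn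
  dropFn_boolPair dropFn_mem_FP)
open _root_.Computability Polynomial

namespace WeakOW

/-! ### Generic facts -/

/-- Monotonicity of `RandAlg.pr` along an implication between output events of two algorithms on two
inputs using the SAME NUMBER of coins: if every coin string putting `A`'s output (on `z`) in `S` puts
`A'`'s output (on `z'`) in `E`, then `Pr[A(z) ∈ S] ≤ Pr[A'(z') ∈ E]` (`RandAlg.pr_eq_uniformProb`).
[folklore] -/
theorem pr_le_pr_of_forall {A A' : RandAlg (List Bool) (List Bool)} {z z' : List Bool}
    (hcoin : A.coinLen z.length = A'.coinLen z'.length) {S E : Set (List Bool)}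
    (h : ∀ r, A.run z r ∈ S → A'.run z' r ∈ E) : A.pr id z S ≤ A'.pr id z' E := by
  classical
  rw [RandAlg.pr_eq_uniformProb, RandAlg.pr_eq_uniformProb]
  change uniformProb (A.coinLen z.length) _ ≤ uniformProb (A'.coinLen z'.length) _
  rw [hcoin]
  unfold uniformProb
  refine div_le_div_of_nonneg_right ?_ (by positivity)
  exact_mod_cast Finset.card_le_card fun r hr => by
    simp only [Finset.mem_filter, Finset.mem_univ, true_and, Set.mem_setOf_eq] at hr ⊢
    exact h _ hr

/-! ### The event inclusion: an `fPQ`-preimage of a hard-branch image reveals `{P, Q}` -/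

/-- **Event inclusion.** If `fPQ z = 1 · encW n (P · Q)` for primes `P, Q` with `P Q < 2ⁿ`, then the
smaller half of `z` is `min P Q`: `z` is on the hard branch (the tag), `|z| = n`, the width-`n`
numerals of `pOf z · qOf z` and `P Q` agree and are exact (`Extract.pOf_mul_qOf_lt`, `Canon.bitsToNat_encW`),
and a product of
two primes determines the pair. [Goldreich 2001, §2.2.4.1] -/
theorem min_eq_of_fPQ_eq {z : List Bool} {n P Q : ℕ} (hP : P.Prime) (hQ : Q.Prime)
    (hPQ : P * Q < 2 ^ n) (h : fPQ z = true :: encW n (P * Q)) : min (pOf z) (qOf z) = min P Q := by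
  by_cases hz : isPrimePair z = true
  · obtain ⟨hp, hq, -, -⟩ := (isPrimePair_eq_true_iff z).1 hz
    rw [fPQ, if_pos hz, List.cons.injEq] at h
    have hlen : z.length = n := by
      have := congrArg List.length h.2
      rwa [length_encW, length_encW] at this
    have hval : pOf z * qOf z = P * Q := by
      have := congrArg bitsToNat h.2
      rwa [Canon.bitsToNat_encW (hlen ▸ Extract.pOf_mul_qOf_lt z), Canon.bitsToNat_encW hPQ] at this
    have hdvd : pOf z ∣ P * Q := ⟨qOf z, hval.symm⟩
    rcases hp.dvd_mul.1 hdvd with h1 | h1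
    · have e1 : pOf z = P := (Nat.prime_dvd_prime_iff_eq hp hP).1 h1
      rw [e1] at hval
      rw [e1, Nat.eq_of_mul_eq_mul_left hP.pos hval]
    · have e1 : pOf z = Q := (Nat.prime_dvd_prime_iff_eq hp hQ).1 h1
      rw [e1, Nat.mul_comm P Q] at hval
      rw [e1, Nat.eq_of_mul_eq_mul_left hQ.pos hval, min_comm]
  · rw [fPQ, if_neg hz] at h
    exact absurd (List.cons.inj h).1 Bool.false_ne_true

/-! ### The reduction program -/

/-- Selecting the smaller of two numbers by a comparison bit gives the numeral of the minimum.
[folklore] -/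
theorem ite_encodeNat_min (a b : ℕ) :
    (if decide (a < b) then encodeNat a else encodeNat b) = encodeNat (min a b) := by
  by_cases h : a < b
  · rw [decide_eq_true h, if_pos rfl, min_eq_left h.le]
  · rw [decide_eq_false h, min_eq_right (not_lt.1 h)]
    rfl

/-- **The reduction program is in `FP`.** For a PPT `B` and a parity bit `b` there is a
polynomial-time string function `G` with, on `⟨⟨1ᵐ, encodeNat N⟩, c⟩` and `n = 2m + b`,
`G = encodeNat (min (pOf x') (qOf x'))` for `x' = B(⟨1ⁿ, 1 · encW n N⟩; c)` — ONE composite of bricks: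
`u = fstF (fstF w)`, `1ⁿ = u ++ u ++ 1ᵇ`, `encW n N = fstF (padTakeFn ⟨1ⁿ, sndF (fstF w)⟩)`, the call
`uncurry B.run ∘ boolUnpair` on `⟨⟨1ⁿ, 1 · encW n N⟩, sndF w⟩`, halves by `halfFn`/`takeFn`/`dropFn`,
minimum by `iteFn (ltFn ⟨·,·⟩) (norm ·) (norm ·)`. [Arora–Barak 2009, §1.3] -/
theorem exists_program {B : RandAlg (List Bool) (List Bool)} (hB : IsPPT B id) (b : Bool) :
    ∃ G : List Bool → List Bool, G ∈ FP ∧ ∀ (m N : ℕ) (c : List Bool),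
      G (boolPair (boolPair (unaryEncodeNat m) (encodeNat N)) c) =
        encodeNat (min
          (pOf (B.run (boolPair (unaryEncodeNat (2 * m + b.toNat)) (true :: encW (2 * m + b.toNat) N)) c))
          (qOf (B.run (boolPair (unaryEncodeNat (2 * m + b.toNat)) (true :: encW (2 * m + b.toNat) N)) c))) := by
  -- the pieces (local abbreviations)
  set U : List Bool → List Bool := fstF ∘ fstF with hU
  set UN : List Bool → List Bool := fun w => (U w ++ U w) ++ unaryEncodeNat b.toNat with hUN
  set NS : List Bool → List Bool := sndF ∘ fstF with hNS
  set Y : List Bool → List Bool := List.cons true ∘ fstF ∘ padTakeFn ∘ fanoutFn UN NS with hY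
  set WB : List Bool → List Bool := fanoutFn (fanoutFn UN Y) sndF with hWB
  set X' : List Bool → List Bool := (Function.uncurry B.run ∘ boolUnpair) ∘ WB with hX'
  set PU : List Bool → List Bool := takeFn ∘ fanoutFn halfFn id with hPU
  set QU : List Bool → List Bool := takeFn ∘ fanoutFn halfFn (dropFn ∘ fanoutFn halfFn id) with hQU
  set G : List Bool → List Bool :=
    iteFn (ltFn ∘ fanoutFn (PU ∘ X') (QU ∘ X')) (norm ∘ PU ∘ X') (norm ∘ QU ∘ X') with hG
  -- membership in FP
  have mB : (Function.uncurry B.run ∘ boolUnpair) ∈ FP :=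
    PolyTimeComputable.comp_holds hB.1 polyTimeComputable_boolUnpair
  have mU : U ∈ FP := comp_mem_FP fstF_mem_FP fstF_mem_FP
  have mUN : UN ∈ FP := append_mem_FP (append_mem_FP mU mU) (const_mem_FP _)
  have mNS : NS ∈ FP := comp_mem_FP sndF_mem_FP fstF_mem_FP
  have mY : Y ∈ FP := comp_mem_FP (cons_mem_FP true)
    (comp_mem_FP fstF_mem_FP (comp_mem_FP padTakeFn_mem_FP (fanoutFn_mem_FP mUN mNS)))
  have mWB : WB ∈ FP := fanoutFn_mem_FP (fanoutFn_mem_FP mUN mY) sndF_mem_FP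
  have mX' : X' ∈ FP := comp_mem_FP mB mWB
  have mPU : PU ∈ FP := comp_mem_FP takeFn_mem_FP (fanoutFn_mem_FP halfFn_mem_FP OracleCompose.id_mem_FP)
  have mQU : QU ∈ FP :=
    comp_mem_FP takeFn_mem_FP (fanoutFn_mem_FP halfFn_mem_FP
      (comp_mem_FP dropFn_mem_FP (fanoutFn_mem_FP halfFn_mem_FP OracleCompose.id_mem_FP)))
  have mG : G ∈ FP :=
    iteFn_mem_FP (comp_mem_FP ltFn_mem_FP (fanoutFn_mem_FP (comp_mem_FP mPU mX') (comp_mem_FP mQU mX')))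
      (comp_mem_FP norm_mem_FP (comp_mem_FP mPU mX')) (comp_mem_FP norm_mem_FP (comp_mem_FP mQU mX'))
  refine ⟨G, mG, fun m N c => ?_⟩
  -- values on `w = ⟨⟨1ᵐ, encodeNat N⟩, c⟩`
  have hua : ∀ a a' : ℕ, unaryEncodeNat a ++ unaryEncodeNat a' = unaryEncodeNat (a + a') := fun a a' => by
    simp only [OracleCompose.unaryEncodeNat_eq_replicate, List.replicate_append_replicate]
  have hul : ∀ k : ℕ, (unaryEncodeNat k).length = k := unary_decode_encode_nat
  have eUN : UN (boolPair (boolPair (unaryEncodeNat m) (encodeNat N)) c) = unaryEncodeNat (2 * m + b.toNat) := by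
    simp only [hUN, hU, Function.comp_apply, fstF_boolPair, hua, two_mul]
  have eY : Y (boolPair (boolPair (unaryEncodeNat m) (encodeNat N)) c) =
      true :: encW (2 * m + b.toNat) N := by
    simp only [hY, hNS, Function.comp_apply, fanoutFn_apply, eUN, fstF_boolPair, sndF_boolPair,
      FPQ.fstF_padTakeFn_encodeNat, hul]
  have eX' : X' (boolPair (boolPair (unaryEncodeNat m) (encodeNat N)) c) =
      B.run (boolPair (unaryEncodeNat (2 * m + b.toNat)) (true :: encW (2 * m + b.toNat) N)) c := by
    simp only [hX', hWB, Function.comp_apply, fanoutFn_apply, eUN, eY, sndF_boolPair,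
      boolUnpair_boolPair, Function.uncurry_apply_pair]
  have ePU : ∀ x, PU x = x.take (x.length / 2) := fun x => by simp [hPU]
  have eQU : ∀ x, QU x = (x.drop (x.length / 2)).take (x.length / 2) := fun x => by simp [hQU]
  have eC : (ltFn ∘ fanoutFn (PU ∘ X') (QU ∘ X')) (boolPair (boolPair (unaryEncodeNat m) (encodeNat N)) c) =
      [decide (pOf (B.run (boolPair (unaryEncodeNat (2 * m + b.toNat)) (true :: encW (2 * m + b.toNat) N)) c) <
        qOf (B.run (boolPair (unaryEncodeNat (2 * m + b.toNat)) (true :: encW (2 * m + b.toNat) N)) c))] := by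
    simp only [Function.comp_apply, fanoutFn_apply, ltFn_boolPair, eX', ePU, eQU]
    rfl
  have eT : (norm ∘ PU ∘ X') (boolPair (boolPair (unaryEncodeNat m) (encodeNat N)) c) =
      encodeNat (pOf (B.run (boolPair (unaryEncodeNat (2 * m + b.toNat)) (true :: encW (2 * m + b.toNat) N)) c)) := by
    simp only [Function.comp_apply, eX', ePU, norm_eq_encodeNat]
    rfl
  have eF : (norm ∘ QU ∘ X') (boolPair (boolPair (unaryEncodeNat m) (encodeNat N)) c) =
      encodeNat (qOf (B.run (boolPair (unaryEncodeNat (2 * m + b.toNat)) (true :: encW (2 * m + b.toNat) N)) c)) := by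
    simp only [Function.comp_apply, eX', eQU, norm_eq_encodeNat]
    rfl
  rw [hG, iteFn_apply eC, eT, eF]
  exact ite_encodeNat_min _ _

end WeakOW

/-- **The factoring adversary** (part (B) of stub `stub_weakOW`, registered sub-goal
`stub_weakOW_adversary`). For every PPT inverter `B` of `fPQ` and parity bit `b` there is a PPT `A`
(run map `WeakOW.exists_program`, coins `B`'s on length `3(2⌊(ℓ-1)/4⌋ + b) + 3`) such that for all
`m ≥ 1` and `m`-bit primes `P, Q`, `B`'s probability of inverting `fPQ` at the hard-branch block
`encW m P ++ encW m Q ++ 0ᵇ` (length `n = 2m + b`, image `1 · encW n (P Q)`, `Canon.fPQ_halves`) is at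
most `A`'s probability of printing `encodeNat (min P Q)` on `⟨1ᵐ, P Q⟩`: both use
`coinLen_B (3n + 3)` coins (`|encodeNat (P Q)| ∈ {2m-1, 2m}`), and coin string by coin string a
successful inversion makes `A` print the smaller prime (`WeakOW.min_eq_of_fPQ_eq`).
[Goldreich 2001, §2.2.4.1] -/
theorem stub_weakOW_adversary {B : RandAlg (List Bool) (List Bool)} (hB : IsPPT B id) (b : Bool) :
    ∃ A : RandAlg (List Bool) (List Bool), IsPPT A id ∧
      ∀ m, 1 ≤ m → ∀ P ∈ mbitPrimes m, ∀ Q ∈ mbitPrimes m,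
        B.pr id (boolPair (unaryEncodeNat (2 * m + b.toNat))
            (fPQ (encW m P ++ encW m Q ++ List.replicate b.toNat false)))
          {z | fPQ z = fPQ (encW m P ++ encW m Q ++ List.replicate b.toNat false)} ≤
        A.pr id (boolPair (unaryEncodeNat m) (encodeNat (P * Q))) {y | encodeNat (min P Q) <+: y} := by
  obtain ⟨G, hG, hGval⟩ := WeakOW.exists_program hB b
  obtain ⟨pB, hpB⟩ := hB.2
  -- the adversary (anonymous): run `G` on the pair presentation, `B`'s coins on length `3n + 3`
  obtain ⟨A, hrun, hcoin⟩ : ∃ A : RandAlg (List Bool) (List Bool),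
      (∀ z r, A.run z r = G (boolPair z r)) ∧
      ∀ ℓ, A.coinLen ℓ = B.coinLen (3 * (2 * ((ℓ - 1) / 4) + b.toNat) + 3) :=
    ⟨⟨fun z r => G (boolPair z r), fun ℓ => B.coinLen (3 * (2 * ((ℓ - 1) / 4) + b.toNat) + 3)⟩,
      fun _ _ => rfl, fun _ => rfl⟩
  have hb1 : b.toNat ≤ 1 := Bool.toNat_le b
  refine ⟨A, ⟨?_, pB.comp (C 3 * X + C 6), fun ℓ => ?_⟩, fun m hm P hP Q hQ => ?_⟩
  · -- the run map is `G` on the pair presentation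
    exact PolyTimeComputable.of_encode_eq (ea := id) (eb := id) (f := G)
      (fun q : List Bool × List Bool => boolPair q.1 q.2) (fun _ => rfl) (fun q => (hrun q.1 q.2).symm) hG
  · -- the coin budget is polynomial
    rw [hcoin, eval_comp]
    refine (hpB _).trans (TM2Iter.eval_mono pB ?_)
    have h4 : 2 * ((ℓ - 1) / 4) ≤ ℓ := by omega
    simp only [eval_add, eval_mul, eval_C, eval_X]
    omega
  · -- the reduction, block by block
    obtain ⟨hPp, hP1, hP2⟩ := mem_mbitPrimes.1 hP
    obtain ⟨hQp, hQ1, hQ2⟩ := mem_mbitPrimes.1 hQ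
    set n := 2 * m + b.toNat with hn
    have hmn : n / 2 = m := by omega
    have hbn : n - 2 * m = b.toNat := by omega
    obtain ⟨hfx, hlen⟩ := Canon.fPQ_halves (n := n) hPp hQp (by rw [hmn]; exact hP1) (by rw [hmn]; exact hQ1)
      (by rw [hmn]; exact hP2) (by rw [hmn]; exact hQ2)
    rw [hmn] at hfx hlen
    rw [hbn] at hfx hlen
    have hPQ2 : P * Q < 2 ^ (2 * m) :=
      calc P * Q < 2 ^ m * 2 ^ m := Nat.mul_lt_mul'' hP2 hQ2
        _ = 2 ^ (2 * m) := by rw [← Nat.pow_add, Nat.two_mul]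
    have hPQ : P * Q < 2 ^ n := hPQ2.trans_le (Nat.pow_le_pow_right two_pos (by omega))
    -- the two inputs have coin budgets of the same size: `|encodeNat (P Q)| ∈ {2m-1, 2m}`
    have hs2 : (P * Q).size ≤ 2 * m := Nat.size_le.2 hPQ2
    have hs1 : 2 * m - 1 ≤ (P * Q).size := by
      have h : 2 ^ (2 * m - 2) ≤ P * Q :=
        calc 2 ^ (2 * m - 2) = 2 ^ (m - 1) * 2 ^ (m - 1) := by rw [← Nat.pow_add]; congr 1; omega
          _ ≤ P * Q := Nat.mul_le_mul hP1 hQ1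
      have := Nat.lt_size.2 h
      omega
    refine WeakOW.pr_le_pr_of_forall ?_ fun r hr => ?_
    · show B.coinLen (boolPair (unaryEncodeNat n) (fPQ _)).length =
        A.coinLen (boolPair (unaryEncodeNat m) (encodeNat (P * Q))).length
      have hul : ∀ k : ℕ, (unaryEncodeNat k).length = k := unary_decode_encode_nat
      rw [hcoin, length_boolPair, length_boolPair, hul, hul, length_fPQ, hlen, TM2Pass.length_encodeNat_eq_size]
      congr 1
      omega
    · -- a successful inversion makes `A` print `encodeNat (min P Q)`
      simp only [Set.mem_setOf_eq] at hr ⊢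
      rw [hrun, hGval, ← hn, ← hfx, WeakOW.min_eq_of_fPQ_eq hPp hQp hPQ (hr.trans hfx)]

end Summit.QuantumAdvantage.QuantumAdvantage.Theorems.WhiteBoxWalk

end
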